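import Summits.BirchSwinnertonDyer.BirchSwinnertonDyer.Theses.SignedBaseChange
import Literature.NumberTheory.EllipticCurves.LiTianYanZhu2025.CyclotomicMainConjectureOrderProofs
import Literature.NumberTheory.GaloisRepresentations.WeakAbelianDirectSummandProofs
import HarnessLib

/-!
# SignedBaseChange — the Katz half of F `GreenbergFramesAtSupersingular`, BY NAME from de Shalit II.4.17

Helper for item stmt-BirchSwinnertonDyer-20086 (split child F of K2 on route SignedBaseChange).
F's first conjunct (and the registered stub `stub_katzFrame` of its birth skeleton) asserts that a Katz
two-variable frame `(Ω, δ, Ω_p, L_K)` with `IsKatzMeasure₂ ι v v̄ ∅ κ₁ κ₂ γ₁⁻¹ γ₂⁻¹ 1 Ω δ Ω_p L_K` EXISTS.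
In the tree de Shalit's existence theorem is the NAMED FACT
`Literature.NumberTheory.EllipticCurves.DeShalit1987.thmII417_exists_katzSheet` (hypothesis-only), so the
closable form is the conditional one proved here: `thmII417_exists_katzSheet → (Katz conjunct of F)`, via
`Literature.NumberTheory.EllipticCurves.exists_isKatzMeasure₂_invGenerators` (the frame read at the inverse
generators) at modulus `S = ∅` and `λ = 1` (finite order ⇒ algebraic; unramified everywhere by `rfl`).
`stub_katzFrame_of_katzSheet` is literally `thmII417_exists_katzSheet →` the registered stub's statement
(its unused binders `5 ≤ p`, `#primesOver = 2`, `IsCyclotomic`, `IsAnticyclotomic`, the `NeZero`/generator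
instances kept verbatim). The planner's repair of F (WAKE-SBC §5) threads this fact to `closes`.
-/

set_option autoImplicit false

namespace Summit.BirchSwinnertonDyer.BirchSwinnertonDyer.Theorems.SignedBaseChangeKatzFrame

/-- de Shalit II.4.17 (named fact) ⇒ the Katz frame of F at `S = ∅`, `λ = 1`, inverse generators. -/
theorem katzFrame_of_katzSheet
    (hdS : Literature.NumberTheory.EllipticCurves.DeShalit1987.thmII417_exists_katzSheet)
    {p : ℕ} [Fact p.Prime] (ι : PadicAlgCl p ≃+* ℂ) (K : Type) [Field K] [NumberField K]
    (v vbar : IsDedekindDomain.HeightOneSpectrum (NumberField.RingOfIntegers K))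
    (κ₁ κ₂ : Literature.NumberTheory.EllipticCurves.ZpExtension K p) (γ₁ γ₂ : Field.absoluteGaloisGroup K)
    (hpair : Literature.NumberTheory.EllipticCurves.ZpExtension.IsTopGeneratorPair κ₁ κ₂ γ₁ γ₂)
    (hK : Literature.NumberTheory.EllipticCurves.IsImaginaryQuadratic K)
    (hv : ((p : ℕ) : NumberField.RingOfIntegers K) ∈ v.asIdeal)
    (hvbar : ((p : ℕ) : NumberField.RingOfIntegers K) ∈ vbar.asIdeal) (hne : vbar ≠ v)
    (hι : ∀ (w : NumberField.InfinitePlace K) (k : NumberField.RingOfIntegers K),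
      k ∈ v.asIdeal ↔ ‖ι.symm (w.embedding (k : K))‖ < 1) :
    ∃ (Ω δ : ℂ) (Ωp : (Literature.NumberTheory.EllipticCurves.unrIntegers p)ˣ)
        (LK : PowerSeries (PowerSeries (PadicComplexInt p))),
      Ω ≠ 0 ∧ (δ ^ 2 = (NumberField.discr K : ℂ) ∨ δ ^ 2 = -(NumberField.discr K : ℂ)) ∧
      Literature.NumberTheory.EllipticCurves.IsKatzMeasure₂ ι v vbar ∅ κ₁ κ₂ γ₁⁻¹ γ₂⁻¹ 1 Ω δ
        ((Ωp : Literature.NumberTheory.EllipticCurves.unrIntegers p) : PadicComplex p) LK := by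
  obtain ⟨Ω, δ, Ωp, hΩ, hδ, hall⟩ :=
    Literature.NumberTheory.EllipticCurves.exists_isKatzMeasure₂_invGenerators hdS hK ι v vbar hv hvbar hne hι
  have halg : (1 : Literature.NumberTheory.GaloisRepresentations.HeckeCharacter K).IsAlgebraic :=
    Literature.NumberTheory.GaloisRepresentations.HeckeCharacter.IsFiniteOrder.isAlgebraic
      IsOfFinOrder.one
  have hunr : ∀ w : IsDedekindDomain.HeightOneSpectrum (NumberField.RingOfIntegers K), w ∉ (∅ : Finset _) →
      w ≠ v → w ≠ vbar →
      (1 : Literature.NumberTheory.GaloisRepresentations.HeckeCharacter K).IsUnramifiedAt w :=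
    fun w _ _ _ => fun _ => rfl
  obtain ⟨H, hH⟩ := hall ∅ (Finset.notMem_empty v) (Finset.notMem_empty vbar) 1 halg hunr κ₁ κ₂ γ₁ γ₂ hpair
  exact ⟨Ω, δ, Ωp, H, hΩ, hδ, hH⟩

/-- The CONDITIONAL form of the registered stub `stub_katzFrame` of F's birth skeleton
(`Cruxes.GreenbergFramesAtSupersingular.Birth`): de Shalit's named fact `→` the stub's statement verbatim. -/
theorem stub_katzFrame_of_katzSheet
    (hdS : Literature.NumberTheory.EllipticCurves.DeShalit1987.thmII417_exists_katzSheet) :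
    ∀ {p : ℕ} [Fact p.Prime] (ι : PadicAlgCl p ≃+* ℂ) (K : Type) [Field K] [NumberField K]
    (v vbar : IsDedekindDomain.HeightOneSpectrum (NumberField.RingOfIntegers K))
    (κ₁ κ₂ : Literature.NumberTheory.EllipticCurves.ZpExtension K p) (γ₁ γ₂ : Field.absoluteGaloisGroup K)
    [Fact (Literature.NumberTheory.EllipticCurves.ZpExtension.IsTopGeneratorPair κ₁ κ₂ γ₁ γ₂)]
    [NeZero (NumberField.discr K).natAbs],
    5 ≤ p → Literature.NumberTheory.EllipticCurves.IsImaginaryQuadratic K →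
    ((Ideal.span {(p : ℤ)}).primesOver (NumberField.RingOfIntegers K)).ncard = 2 →
    ((p : ℕ) : NumberField.RingOfIntegers K) ∈ v.asIdeal →
    ((p : ℕ) : NumberField.RingOfIntegers K) ∈ vbar.asIdeal → vbar ≠ v →
    (∀ (w : NumberField.InfinitePlace K) (k : NumberField.RingOfIntegers K),
      k ∈ v.asIdeal ↔ ‖ι.symm (w.embedding (k : K))‖ < 1) →
    κ₁.IsCyclotomic → κ₂.IsAnticyclotomic →
    ∃ (Ω δ : ℂ) (Ωp : (Literature.NumberTheory.EllipticCurves.unrIntegers p)ˣ)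
        (LK : PowerSeries (PowerSeries (PadicComplexInt p))),
      Ω ≠ 0 ∧ (δ ^ 2 = (NumberField.discr K : ℂ) ∨ δ ^ 2 = -(NumberField.discr K : ℂ)) ∧
      Literature.NumberTheory.EllipticCurves.IsKatzMeasure₂ ι v vbar ∅ κ₁ κ₂ γ₁⁻¹ γ₂⁻¹ 1 Ω δ
        ((Ωp : Literature.NumberTheory.EllipticCurves.unrIntegers p) : PadicComplex p) LK := by
  intro p _ ι K _ _ v vbar κ₁ κ₂ γ₁ γ₂ hpair _ _ hK _ hv hvbar hne hι _ _
  exact katzFrame_of_katzSheet hdS ι K v vbar κ₁ κ₂ γ₁ γ₂ hpair.out hK hv hvbar hne hι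

end Summit.BirchSwinnertonDyer.BirchSwinnertonDyer.Theorems.SignedBaseChangeKatzFrame
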